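import Summits.HodgeConjecture.CorCM.MumfordTateLieAlgebraOfCMType
import Literature.AlgebraicGeometry.Motives.HodgeThetaCMCriterion
import HarnessLib

/-!
# A complex abelian variety is of CM type iff the Hodge operator of `H¹X` lies in `End_Hdg(H¹X) ⊗ ℂ`

COR-CM (cell `pub-hodgecm2`, seat `b27` gen 36, count-neutral lane MT-REDUCTIVE; theorems only, no definition, no named fact;
UNCONDITIONAL — nothing here uses or asserts HC_CM).  Mumford's criterion (Math. Ann. 181 (1969) §2; Deligne LNM 900 I Ex. 3.7 /
Prop. 3.4: «`A` is of CM type iff `MT(A)` is a torus iff `h` factors through a commutative subalgebra of `End⁰(A) ⊗ ℝ`») in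
infinitesimal form, from the tree's `isOfCMType_iff_mumfordTateLieAlgebra_le_endAlg` and the minimality-free Lie lemma
`HodgeStructure.mumfordTateLieAlgebra_le_endAlg_iff_exists_theta_mem_spanC_endAlg` (`Motives/HodgeThetaCMCriterion`).

* **`isOfCMType_iff_exists_theta_mem_spanC_endAlg`** — `X` is of CM type iff some (equivalently every) Hodge operator `Θ` of
  `H¹(X(ℂ); ℚ)` (`= ±1` on `H^{1,0}` / `H^{0,1}`) lies in the complex span of the Hodge endomorphisms `End_Hdg(H¹X)`
  (`≅ End⁰(X)ᵒᵖ ⊗ ℂ` by Riemann's theorem).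

## References
* [Deligne1982HodgeCycles] P. Deligne, LNM 900 (1982), I Ex. 3.7, Prop. 3.4.
* [MoonenZarhin1999LowDim] B. Moonen, Yu. Zarhin, Math. Ann. 315 (1999), §2.
-/

noncomputable section

open CategoryTheory CategoryTheory.Limits Module
open scoped BigOperators TensorProduct

namespace Summit.HodgeConjecture.CorCM

open Literature.AlgebraicGeometry.Motives
open Literature.AlgebraicGeometry.Motives.AbelianVariety
open Literature.AlgebraicGeometry.Motives.HodgeStructure
open Literature.AlgebraicGeometry.HodgeTheory
open Literature.AlgebraicGeometry.Milne1999 (IsOfCMType)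

variable [HodgeTensorFacts.{0, 0}] {X : AbelianVariety ℂ} {n : ℕ}

/-- **`X` is of CM type iff a Hodge operator of `H¹X` lies in `End_Hdg(H¹X) ⊗ ℂ`** (Mumford's criterion, infinitesimal form;
`⟸` uses no minimality of the Hodge group: `Lie Hg` commutes with `End_Hdg`, hence with `Θ`, hence preserves the Hodge pieces).
[cite: Deligne1982HodgeCycles, I §3 Prop. 3.4] [cite: MoonenZarhin1999LowDim, §2] -/
theorem isOfCMType_iff_exists_theta_mem_spanC_endAlg (hX : IsSmoothProjective n X.X) :
    haveI := BettiUniverse.finite hX 1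
    IsOfCMType X ↔
      ∃ Θ : Module.End ℂ (ℂ ⊗[ℚ] bettiCohomology X.X 1),
        (∀ p, ∀ x ∈ (BettiUniverse.hodge exists_isReal_hodgeModel_holds hX 1).piece p ((1 : ℕ) - p),
          Θ x = ((2 * p - (1 : ℕ) : ℤ) : ℂ) • x) ∧
        Θ ∈ spanC (Subalgebra.toSubmodule (BettiUniverse.hodge exists_isReal_hodgeModel_holds hX 1).endAlg) := by
  haveI := BettiUniverse.finite hX 1
  rw [isOfCMType_iff_mumfordTateLieAlgebra_le_endAlg hX]
  exact mumfordTateLieAlgebra_le_endAlg_iff_exists_theta_mem_spanC_endAlg _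

/-- **If `X` is of CM type, EVERY Hodge operator of `H¹X` lies in `End_Hdg(H¹X) ⊗ ℂ`.** [cite: Deligne1982HodgeCycles, I §3 Prop. 3.4] -/
theorem theta_mem_spanC_endAlg_of_isOfCMType (hX : IsSmoothProjective n X.X) (hcm : IsOfCMType X)
    {Θ : Module.End ℂ (ℂ ⊗[ℚ] bettiCohomology X.X 1)}
    (hΘ : haveI := BettiUniverse.finite hX 1
      ∀ p, ∀ x ∈ (BettiUniverse.hodge exists_isReal_hodgeModel_holds hX 1).piece p ((1 : ℕ) - p),
        Θ x = ((2 * p - (1 : ℕ) : ℤ) : ℂ) • x) :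
    haveI := BettiUniverse.finite hX 1
    Θ ∈ spanC (Subalgebra.toSubmodule (BettiUniverse.hodge exists_isReal_hodgeModel_holds hX 1).endAlg) := by
  haveI := BettiUniverse.finite hX 1
  have hle := (isOfCMType_iff_mumfordTateLieAlgebra_le_endAlg hX).1 hcm
  rw [← hodgeLie_le_endAlg_iff] at hle
  exact theta_mem_spanC_endAlg_of_hodgeLie_le_endAlg _ hle hΘ

/-- **If some Hodge operator of `H¹X` lies in `End_Hdg(H¹X) ⊗ ℂ`, then `X` is of CM type.** [cite: Deligne1982HodgeCycles, I §3 Prop. 3.4]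
[cite: MoonenZarhin1999LowDim, §2] -/
theorem isOfCMType_of_theta_mem_spanC_endAlg (hX : IsSmoothProjective n X.X)
    {Θ : Module.End ℂ (ℂ ⊗[ℚ] bettiCohomology X.X 1)}
    (hΘ : haveI := BettiUniverse.finite hX 1
      ∀ p, ∀ x ∈ (BettiUniverse.hodge exists_isReal_hodgeModel_holds hX 1).piece p ((1 : ℕ) - p),
        Θ x = ((2 * p - (1 : ℕ) : ℤ) : ℂ) • x)
    (hΘE : haveI := BettiUniverse.finite hX 1
      Θ ∈ spanC (Subalgebra.toSubmodule (BettiUniverse.hodge exists_isReal_hodgeModel_holds hX 1).endAlg)) :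
    IsOfCMType X :=
  (isOfCMType_iff_exists_theta_mem_spanC_endAlg hX).2 ⟨Θ, hΘ, hΘE⟩

end Summit.HodgeConjecture.CorCM

end
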